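import Mathlib
import Summits.PneNP.PneNP.Theorems.Nc03AvoidResidualCoreCandStarProgram

/-!
# Route Nc03AvoidResidualCore, crux `CandStarReduction` (X₂) — the tangled-surplus solver, Ib: reading genuine instances

Helper file for `stmt-PneNP-19963` (sequel of `…CandStarProgram`; cell pnp-ideate, rung F-N1b). The program of
`…CandStarProgram` runs on raw triples; here its pieces are READ on the raw form `rawOf J` of a genuine
instance `J : LocalMap 3 N M`: the (F1) test and search (`parB_iff`, `findPar_eq_none_iff`,
`findPar_eq_some`), the cherry test and apex (`shareB_iff`, `apexOf_spec`), the chosen cherries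
(`cher_spec`: two outputs `j < j'` with equal heads reading the apex in data roles; `cher_pairwise`;
`cher_maximal`: every cherry pair meets a chosen cherry), and the forcing / pattern / cover lists
(`isF_iff`, `sig_iff`, `mem_edgeL_iff`, `mem_covL_iff`).

Restricted-model (NC⁰₃) range-avoidance rung F-N1b of the PneNP frontier ladder; no bearing on P vs NP.
-/

set_option linter.dupNamespace false -- `Summit.PneNP.PneNP.…`: summit = sub-problem name (D-0017 single-conjunct layout)

namespace Summit.PneNP.PneNP.Theorems.Nc03CandStar

open Literature.Computability.Complexity Nc03Reduction
open Summit.PneNP.PneNP.Theorems.Nc03AvoidResidualCoreCandFewHeadsRungFP (tri)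

/-! ## Reading genuine instances -/

section Reading

variable {N M : ℕ} (J : LocalMap 3 N M)

/-- Entry `j < M` of the triple list of `rawOf J` is output `j`. -/
@[simp] theorem tri_rawOf (j : Fin M) : tri (rawOf J).2.2 j.val = tripOf J j := by
  rw [rawOf_eq]
  unfold tri
  rw [List.getD_eq_getElem?_getD, List.getElem?_ofFn]
  simp [j.isLt]

/-- Membership in `prs`. -/
theorem mem_prs {p : ℕ × ℕ} : p ∈ prs M ↔ p.1 < M ∧ p.2 < M := by
  obtain ⟨a, b⟩ := p
  unfold prs
  rw [List.pair_mem_product, List.mem_range, List.mem_range]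

/-- Members of `prs M` are pairs of genuine indices. -/
theorem exists_fin_of_mem_prs {p : ℕ × ℕ} (hp : p ∈ prs M) : ∃ j j' : Fin M, p = (j.val, j'.val) := by
  obtain ⟨h1, h2⟩ := mem_prs.1 hp
  exact ⟨⟨p.1, h1⟩, ⟨p.2, h2⟩, rfl⟩

open Summit.PneNP.PneNP.Theorems.Nc03AvoidResidualCoreCandFewHeadsRung (pset)

/-- Reading the (F1) test: distinct outputs with equal heads and equal data pairs. -/
theorem parB_iff (j j' : Fin M) :
    parB (rawOf J).2.2 (j.val, j'.val) = true ↔ j ≠ j' ∧ J.vars j 0 = J.vars j' 0 ∧ pset J j = pset J j' := by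
  unfold parB
  simp only [tri_rawOf, tripOf, Bool.and_eq_true, Bool.not_eq_true', decide_eq_false_iff_not,
    decide_eq_true_eq, Bool.or_eq_true, Fin.val_inj, ne_eq]
  constructor
  · rintro ⟨⟨hne, hh⟩, h⟩
    refine ⟨hne, hh, ?_⟩
    unfold pset
    rcases h with ⟨h1, h2⟩ | ⟨h1, h2⟩
    · rw [h1, h2]
    · rw [h1, h2, Finset.pair_comm]
  · rintro ⟨hne, hh, hp⟩
    refine ⟨⟨hne, hh⟩, ?_⟩
    unfold pset at hp
    rcases Nc03AvoidResidualCoreCandFewHeadsRung.pair_eq_pair hp with ⟨h1, h2⟩ | ⟨h1, h2⟩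
    · exact Or.inl ⟨h1, h2⟩
    · exact Or.inr ⟨h1, h2⟩

/-- **No parallel pair**: the (F1) search fails iff no two distinct outputs have equal heads and equal
data pairs. -/
theorem findPar_eq_none_iff :
    findPar (rawOf J) = none ↔ ∀ j j' : Fin M, j ≠ j' → J.vars j 0 = J.vars j' 0 → pset J j ≠ pset J j' := by
  unfold findPar
  rw [List.find?_eq_none, rawOf_M]
  constructor
  · intro h j j' hne hh hp
    exact h (j.val, j'.val) (mem_prs.2 ⟨j.isLt, j'.isLt⟩) ((parB_iff J j j').2 ⟨hne, hh, hp⟩)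
  · intro h p hp hpar
    obtain ⟨j, j', rfl⟩ := exists_fin_of_mem_prs hp
    obtain ⟨hne, hh, hps⟩ := (parB_iff J j j').1 hpar
    exact h j j' hne hh hps

/-- Reading a hit of the (F1) search. -/
theorem findPar_eq_some {p : ℕ × ℕ} (h : findPar (rawOf J) = some p) :
    ∃ j j' : Fin M, p = (j.val, j'.val) ∧ j ≠ j' ∧ J.vars j 0 = J.vars j' 0 ∧ pset J j = pset J j' := by
  unfold findPar at h
  have hp := List.mem_of_find?_eq_some h
  rw [rawOf_M] at hp
  obtain ⟨j, j', rfl⟩ := exists_fin_of_mem_prs hp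
  have ht := List.find?_some h
  exact ⟨j, j', rfl, (parB_iff J j j').1 ht⟩

/-- Reading the cherry test: `j < j'`, equal heads, and a common data variable in data roles. -/
theorem shareB_iff (j j' : Fin M) :
    shareB (rawOf J).2.2 (j.val, j'.val) = true ↔
      j < j' ∧ J.vars j 0 = J.vars j' 0 ∧ ∃ r r' : Fin 3, r ≠ 0 ∧ r' ≠ 0 ∧ J.vars j r = J.vars j' r' := by
  unfold shareB
  simp only [tri_rawOf, tripOf, Bool.and_eq_true, decide_eq_true_eq, Bool.or_eq_true, Fin.val_inj,
    Fin.lt_def]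
  constructor
  · rintro ⟨⟨hlt, hh⟩, h⟩
    refine ⟨hlt, hh, ?_⟩
    rcases h with ((h | h) | h) | h
    · exact ⟨1, 1, by decide, by decide, h⟩
    · exact ⟨1, 2, by decide, by decide, h⟩
    · exact ⟨2, 1, by decide, by decide, h⟩
    · exact ⟨2, 2, by decide, by decide, h⟩
  · rintro ⟨hlt, hh, r, r', hr, hr', h⟩
    refine ⟨⟨hlt, hh⟩, ?_⟩
    have hr3 : r = 1 ∨ r = 2 := by
      rcases r with ⟨_ | _ | _ | r, h3⟩
      · exact absurd rfl hr
      · exact Or.inl rfl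
      · exact Or.inr rfl
      · omega
    have hr3' : r' = 1 ∨ r' = 2 := by
      rcases r' with ⟨_ | _ | _ | r, h3⟩
      · exact absurd rfl hr'
      · exact Or.inl rfl
      · exact Or.inr rfl
      · omega
    rcases hr3 with rfl | rfl <;> rcases hr3' with rfl | rfl
    · exact Or.inl (Or.inl (Or.inl h))
    · exact Or.inl (Or.inl (Or.inr h))
    · exact Or.inl (Or.inr h)
    · exact Or.inr h

/-- The apex of a cherry pair is a common data variable of the two outputs. -/
theorem apexOf_spec {j j' : Fin M} (h : shareB (rawOf J).2.2 (j.val, j'.val) = true) :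
    ∃ r r' : Fin 3, r ≠ 0 ∧ r' ≠ 0 ∧ (J.vars j r).val = apexOf (rawOf J).2.2 (j.val, j'.val) ∧
      J.vars j r = J.vars j' r' := by
  unfold apexOf
  simp only [tri_rawOf, tripOf, Fin.val_inj]
  obtain ⟨-, -, r, r', hr, hr', hrr⟩ := (shareB_iff J j j').1 h
  by_cases hc : J.vars j 1 = J.vars j' 1 ∨ J.vars j 1 = J.vars j' 2
  · rw [if_pos hc]
    rcases hc with hc | hc
    · exact ⟨1, 1, by decide, by decide, rfl, hc⟩
    · exact ⟨1, 2, by decide, by decide, rfl, hc⟩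
  · rw [if_neg hc]
    have hr3 : r = 1 ∨ r = 2 := by
      rcases r with ⟨_ | _ | _ | r, h3⟩
      · exact absurd rfl hr
      · exact Or.inl rfl
      · exact Or.inr rfl
      · omega
    have hr3' : r' = 1 ∨ r' = 2 := by
      rcases r' with ⟨_ | _ | _ | r, h3⟩
      · exact absurd rfl hr'
      · exact Or.inl rfl
      · exact Or.inr rfl
      · omega
    rcases hr3 with rfl | rfl
    · exfalso
      rcases hr3' with rfl | rfl
      · exact hc (Or.inl hrr)
      · exact hc (Or.inr hrr)
    · exact ⟨2, r', by decide, hr', rfl, hrr⟩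

/-- Members of the candidate list. -/
theorem mem_cherryCands_iff {c : ℕ × ℕ × ℕ} :
    c ∈ cherryCands (rawOf J) ↔ ∃ j j' : Fin M, shareB (rawOf J).2.2 (j.val, j'.val) = true ∧
      c = (apexOf (rawOf J).2.2 (j.val, j'.val), j.val, j'.val) := by
  unfold cherryCands
  rw [rawOf_M, List.mem_map]
  constructor
  · rintro ⟨p, hp, rfl⟩
    rw [List.mem_filter] at hp
    obtain ⟨j, j', rfl⟩ := exists_fin_of_mem_prs hp.1
    exact ⟨j, j', hp.2, rfl⟩
  · rintro ⟨j, j', hs, rfl⟩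
    exact ⟨(j.val, j'.val), List.mem_filter.2 ⟨mem_prs.2 ⟨j.isLt, j'.isLt⟩, hs⟩, rfl⟩

/-- **Reading a chosen cherry**: two outputs `j < j'` with equal heads and apex `u`, a common data
variable, `u` read in data roles of both. -/
theorem cher_spec {q : ℕ × ℕ × ℕ} (hq : q ∈ cher (rawOf J)) :
    ∃ j j' : Fin M, ∃ u : Fin N, q = (u.val, j.val, j'.val) ∧ j < j' ∧ J.vars j 0 = J.vars j' 0 ∧
      ∃ r r' : Fin 3, r ≠ 0 ∧ r' ≠ 0 ∧ J.vars j r = u ∧ J.vars j' r' = u := by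
  have hc := (greedy_sublist (cherryCands (rawOf J))).subset hq
  obtain ⟨j, j', hs, rfl⟩ := (mem_cherryCands_iff J).1 hc
  obtain ⟨hlt, hh, -⟩ := (shareB_iff J j j').1 hs
  obtain ⟨r, r', hr, hr', hval, hrr⟩ := apexOf_spec J hs
  exact ⟨j, j', J.vars j r, by rw [hval], hlt, hh, r, r', hr, hr', rfl, hrr.symm⟩

/-- The chosen cherries are pairwise clash-free. -/
theorem cher_pairwise : (cher (rawOf J)).Pairwise fun q c => clash q c = false := greedy_pairwise _

/-- Unfolding a non-clash. -/
theorem clash_eq_false_iff {q c : ℕ × ℕ × ℕ} : clash q c = false ↔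
    q.1 ≠ c.1 ∧ q.2.1 ≠ c.2.1 ∧ q.2.1 ≠ c.2.2 ∧ q.2.2 ≠ c.2.1 ∧ q.2.2 ≠ c.2.2 := by
  unfold clash
  simp only [Bool.or_eq_false_iff, decide_eq_false_iff_not]
  tauto

/-- **Maximality, read on a genuine instance**: two outputs `j < j'` with equal heads and a common data
variable meet a chosen cherry — at its apex (`apexOf`) or at an edge. -/
theorem cher_maximal {j j' : Fin M} (hs : shareB (rawOf J).2.2 (j.val, j'.val) = true) :
    ∃ q ∈ cher (rawOf J), q.1 = apexOf (rawOf J).2.2 (j.val, j'.val) ∨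
      q.2.1 = j.val ∨ q.2.1 = j'.val ∨ q.2.2 = j.val ∨ q.2.2 = j'.val := by
  obtain ⟨q, hq, hc⟩ := exists_clash_of_mem (cherryCands (rawOf J))
    ((mem_cherryCands_iff J).2 ⟨j, j', hs, rfl⟩)
  refine ⟨q, hq, ?_⟩
  unfold clash at hc
  simp only [Bool.or_eq_true, decide_eq_true_eq] at hc
  tauto

/-- Reading `isF`: membership in the apex list. -/
theorem isF_iff (ch : List (ℕ × ℕ × ℕ)) (u : ℕ) : isF ch u = true ↔ ∃ q ∈ ch, q.1 = u := by
  unfold isF forcedL; simp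

/-- Reading `sig`: membership in the first-edge list. -/
theorem sig_iff (ch : List (ℕ × ℕ × ℕ)) (o : ℕ) : sig ch o = true ↔ ∃ q ∈ ch, q.2.1 = o := by
  unfold sig firstL; simp

/-- Reading `edgeL`. -/
theorem mem_edgeL_iff (ch : List (ℕ × ℕ × ℕ)) (o : ℕ) : o ∈ edgeL ch ↔ ∃ q ∈ ch, q.2.1 = o ∨ q.2.2 = o := by
  unfold edgeL
  simp only [List.mem_append, List.mem_map]
  constructor
  · rintro (⟨q, hq, h⟩ | ⟨q, hq, h⟩)
    · exact ⟨q, hq, Or.inl h⟩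
    · exact ⟨q, hq, Or.inr h⟩
  · rintro ⟨q, hq, h | h⟩
    · exact Or.inl ⟨q, hq, h⟩
    · exact Or.inr ⟨q, hq, h⟩

/-- Reading `covL`: outputs below `M` with a forced data variable. -/
theorem mem_covL_iff (pr : PRaw) (ch : List (ℕ × ℕ × ℕ)) (o : ℕ) :
    o ∈ covL pr ch ↔ o < pr.2.1 ∧ (isF ch (tri pr.2.2 o).2.1 = true ∨ isF ch (tri pr.2.2 o).2.2 = true) := by
  unfold covL covB
  rw [List.mem_filter, List.mem_range, Bool.or_eq_true]

end Reading

end Summit.PneNP.PneNP.Theorems.Nc03CandStar
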